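import Literature.AlgebraicGeometry.Resolution.AffinePointBlowupAlgebra
import Literature.AlgebraicGeometry.Resolution.BlowupAlgebraStrictTransform
import Literature.AlgebraicGeometry.Resolution.AffineBlowupResolutionCriterion
import Literature.AlgebraicGeometry.Resolution.Dehomogenization
import Mathlib.RingTheory.MvPolynomial.Homogeneous
import Mathlib.Algebra.MvPolynomial.Division
import Mathlib.Algebra.Prime.Lemmas
import Mathlib.Algebra.MvPolynomial.NoZeroDivisors
import Mathlib.RingTheory.RegularLocalRing.Defs
import Mathlib.RingTheory.RegularLocalRing.Polynomial
import Mathlib.RingTheory.Polynomial.Quotient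
import Mathlib.Algebra.MvPolynomial.Equiv
import HarnessLib

/-!
# Crux `EquisingularLift` (stmt-ResolutionOfSingularities-15660), line `Sketch` (v10c): the OPEN residual `stub_blowupModel_ge_five`
# in ALL characteristics for CONES — ring level: blowing up the vertex of the affine cone over a form `G`

[OURS · leafhand-res-equisingularlift-6 g2, 2026-08-31; cell `pub/decomp-res`] AI-produced, weaker than expert review; NOT a statement of
any manuscript; nothing here proves resolution of singularities in positive characteristic.  DEF-FREE helper, `--supports stmt-…-15660`;
standard axioms; ZERO named hypotheses; EVERY field `K`, every characteristic.

The registered open residual `stub_blowupModel_ge_five` asks for regular blow-up models of integral hypersurfaces `H ⊆ ℙⁿ_k̄`, `n ≥ 5`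
(= projective resolution in dimension `≥ 4` over `k̄`, ✓ `blowupModels_ge_five_iff_projectiveResolutions_ge_five`).  The tree has it
degree by degree in LARGE characteristic (✓ `blowupModel_largeChar`, `p > M(n, d)`, `M` ineffective).  This file starts the first
ALL-CHARACTERISTIC sub-class: CONES `H = V₊(G) ⊆ ℙⁿ`, `G ∈ k[x₀, …, x_{n-1}]` a form not involving `x_n`, over a regular `V₊(G) ⊆ ℙⁿ⁻¹`
(e.g. every quadric of rank `n`).  On the chart `D₊(x_n) = 𝔸ⁿ = Spec K[X₀, …, X_{n-1}]` the cone is the AFFINE CONE `Spec K[X]/(G)` with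
vertex the origin, and the classical computation (Hartshorne II Ex. 7.12; Eisenbud–Harris §9.3.2) says: **blowing up the vertex,
the `i`-th chart of the blown-up cone is `Spec K[X]/(G(X₀, …, 1ᵢ, …, X_{n-1}))`** — the product of the affine chart `D₊(xᵢ) ∩ V₊(G)` of the
base of the cone with the line `𝔸¹` (coordinate `Xᵢ`, the exceptional equation).  PROVED here, at ring level, for EVERY field `K`, every
`n`, every form `G ≠ 0` of degree `e`:

* `substHom_eq_X_pow_mul_of_isHomogeneous` — the chart substitution `xᵢ ↦ xᵢ`, `xⱼ ↦ xᵢ xⱼ` (`AffinePointBlowup.substHom`) takes a form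
  `G` of degree `e` to `xᵢ ^ e · G(xᵢ := 1)` (`G(xᵢ := 1) = aeval (Function.update X i 1) G`, the in-place dehomogenisation);
* `aeval_update_one_ne_zero`, `not_X_dvd_aeval_update_one` — `G(xᵢ := 1) ≠ 0` and `xᵢ ∤ G(xᵢ := 1)` (dehomogenisation is injective on
  forms, ✓ `dehomogenize_ne_zero_of_isHomogeneous`);
* ★ `nonempty_quotient_aeval_update_one_ringEquiv_blowupAlgebra` — **`K[X]/(G(Xᵢ := 1)) ≅ (K[X]/(G))[𝔪̄/X̄ᵢ]`**, the `i`-th affine blowup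
  algebra of the affine cone `K[X]/(G)` along the vertex ideal `𝔪̄ = (X̄₀, …, X̄ₙ)` (✓ `blowupAlgebra.quotientKerMapQuotientEquiv`: the
  chart ring of the blow-up of a hypersurface is the ambient chart ring `K[X][𝔪/Xᵢ] ≅ K[X]` (✓ `AffinePointBlowup.chartRingEquiv`) modulo the
  strict transform `G(Xᵢ := 1)` of the equation, `Xᵢ` being prime in the chart ring and not dividing it);
* ★ `isRegular_affineBlowup_cone_of_forall` — hence **if every `K[X]/(G(Xᵢ := 1))` is a regular ring, the blow-up
  `Bl_𝔪̄ Spec (K[X]/(G))` of the affine cone in its vertex is a REGULAR scheme** (✓ `affineBlowup.isRegular_of_isRegularRing_blowupAlgebra`),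
  and `hasResolution_Spec_cone_of_forall` — for `G` PRIME of degree `e ≥ 2` the affine cone `Spec K[X]/(G)` HAS A RESOLUTION OF
  SINGULARITIES (one blow-up; `X̄₀ ∈ 𝔪̄` is a non-zero-divisor, `mk_X_mem_nonZeroDivisors`; ✓ `hasResolution_Spec_of_isRegularRing_blowupAlgebra`);
* ★ `nonempty_quotient_aeval_update_one_ringEquiv_polynomial` — **`K[X]/(G(Xᵢ := 1)) ≅ (K[Xⱼ : j ≠ i]/(dehomogenize i G))[T]`**: the chart
  ring is the polynomial ring in the exceptional coordinate over the coordinate ring of the affine chart `D₊(xᵢ) ∩ V₊(G)` of the BASE of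
  the cone (`renameEquiv` + `optionEquivLeft` + `Ideal.polynomialQuotientEquivQuotientPolynomial`); `isRegularRing_quotient_aeval_update_one`
  — so it is regular when the base chart is (Mathlib `Polynomial.isRegularRing_of_isRegularRing`);
* ★★ `hasResolution_Spec_cone_of_forall_base` — **for a prime form `G` of degree `≥ 2` ALL of whose affine charts
  `K[xⱼ : j ≠ i]/(G(xᵢ := 1))` are regular rings (i.e. `V₊(G) ⊆ ℙⁿ_K` regular, in coordinates), blowing up the vertex of the affine
  cone `Spec K[x]/(G)` gives a regular scheme, and the affine cone has a resolution of singularities** — EVERY field, EVERY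
  characteristic (e.g. the cone over any regular quadric, cubic, … hypersurface).

REMAINING for the cone sub-class of the residual (repair census, sizes): (c1′) dictionary «`Scheme.IsRegular` of the subscheme
`V((G)~) ⊆ ℙⁿ_K`» ⟹ «every `K[xⱼ : j ≠ i]/(dehomogenize i G)` is a regular ring» (the tree's `Proj` chart isomorphisms
`Γ(V₊(G) ∩ D₊(xᵢ)) ≅ K[xⱼ : j ≠ i]/(dehomogenize i G)`; S–M); (c2) scheme assembly on the projective cone `H = V₊(G) ⊆ ℙⁿ⁺¹`
(`G` not involving `x_{n+1}`): `𝔞 :=` ideal of the vertex, `H ∩ D₊(x_{n+1}) = Spec K[x]/(G)` with `𝔞 ↦ 𝔪̄`, blow-ups restrict to opens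
(✓ `BlowupRestrictOpen`) and are unique (`IsBlowup.unique`), so regularity transfers from the model `affineBlowup`; `H ∩ D₊(xⱼ)`, `j ≤ n`,
is `Spec` of a polynomial ring over the base chart, regular, with `𝔞 = ⊤` there (M–L); (c3) quadrics of any rank: normal forms over `k̄` in
every characteristic + `PGL` transport + vertex of positive dimension (coordinate-subspace blow-up, ✓ `AffineCoordinateBlowupCharts`) (L).
Honest: no registered stub closed; this is the ring-level heart of ONE all-characteristic sub-case of an OPEN problem.

References: [Hartshorne1977, II Ex. 7.12 and I §4 (blowing up a point)]; [EisenbudHarris2016, §9.3.2]; [GortzWedhorn2020, Prop. 13.96 (2),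
(13.19) p. 415, Prop. 13.91]; [StacksProject, Tags 0804, 080E].
-/

set_option linter.dupNamespace false -- mandated namespace `Summit.<Summit>.<Problem>` of this single-conjunct summit

noncomputable section

open MvPolynomial AlgebraicGeometry
open Literature.AlgebraicGeometry.Resolution

universe u

namespace Summit.ResolutionOfSingularities.ResolutionOfSingularities.Cruxes.EquisingularLift.StrataSplit

namespace ConeChart

variable {n : ℕ} {K : Type u} [Field K] (i : Fin (n + 1))

/-! ## The chart substitution on a form: `G(xᵢ, xᵢ xⱼ) = xᵢ ^ e · G(xᵢ := 1)` -/

/-- **The chart substitution takes a form of degree `e` to `xᵢ ^ e` times its in-place dehomogenisation**: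
`substHom i G = X i ^ e * aeval (update X i 1) G` (monomial by monomial: `∏ⱼ (xᵢ xⱼ)^{dⱼ} · xᵢ^{dᵢ} = xᵢ^{|d|} ∏_{j ≠ i} xⱼ^{dⱼ}`).
[cite: EisenbudHarris2016, §9.3.2] -/
theorem substHom_eq_X_pow_mul_of_isHomogeneous {G : AffinePointBlowup.A n K} {e : ℕ} (hG : G.IsHomogeneous e) :
    AffinePointBlowup.substHom n K i G =
      X i ^ e * aeval (Function.update (X : Fin (n + 1) → AffinePointBlowup.A n K) i 1) G := by
  classical
  conv_lhs => rw [G.as_sum]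
  conv_rhs => rw [G.as_sum]
  simp only [map_sum, Finset.mul_sum]
  refine Finset.sum_congr rfl fun d hd => ?_
  have hdeg : e = ∑ j ∈ d.support, d j := hG.degree_eq_sum_deg_support hd
  rw [AffinePointBlowup.substHom, aeval_monomial, aeval_monomial, ← mul_assoc, mul_comm (X i ^ e), mul_assoc]
  congr 1
  rw [Finsupp.prod, Finsupp.prod, hdeg, ← Finset.prod_pow_eq_pow_sum, ← Finset.prod_mul_distrib]
  refine Finset.prod_congr rfl fun j _ => ?_
  by_cases hj : j = i
  · subst hj
    simp
  · rw [if_neg hj, Function.update_of_ne hj, mul_pow]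

/-- `G(xᵢ := 1)` is the tree's dehomogenisation `dehomogenize i G ∈ K[xⱼ : j ≠ i]` renamed back into `K[x]`. [folklore] -/
theorem aeval_update_one_eq_rename_dehomogenize (G : AffinePointBlowup.A n K) :
    aeval (Function.update (X : Fin (n + 1) → AffinePointBlowup.A n K) i 1) G =
      rename (Subtype.val : {j : Fin (n + 1) // j ≠ i} → Fin (n + 1)) (dehomogenize i G) := by
  classical
  rw [dehomogenize, ← AlgHom.comp_apply]
  congr 1
  refine MvPolynomial.algHom_ext fun j => ?_
  rw [AlgHom.comp_apply, aeval_X, aeval_X]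
  by_cases hj : j = i
  · subst hj
    rw [Function.update_self, killVar_self, map_one]
  · rw [Function.update_of_ne hj, killVar_of_ne i hj, rename_X]

/-- **`G(xᵢ := 1) ≠ 0` for a non-zero form `G`** (dehomogenisation is injective on forms). [folklore] -/
theorem aeval_update_one_ne_zero {G : AffinePointBlowup.A n K} {e : ℕ} (hG : G.IsHomogeneous e) (hG0 : G ≠ 0) :
    aeval (Function.update (X : Fin (n + 1) → AffinePointBlowup.A n K) i 1) G ≠ 0 := by
  classical
  rw [aeval_update_one_eq_rename_dehomogenize, Ne, ← map_zero (rename (Subtype.val : {j : Fin (n + 1) // j ≠ i} → Fin (n + 1))),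
    (rename_injective _ Subtype.val_injective).eq_iff]
  exact dehomogenize_ne_zero_of_isHomogeneous i hG hG0

/-- `G(xᵢ := 1)` does not involve `xᵢ`: setting `xᵢ := 0` afterwards changes nothing. [folklore] -/
theorem aeval_update_zero_aeval_update_one (G : AffinePointBlowup.A n K) :
    aeval (Function.update (X : Fin (n + 1) → AffinePointBlowup.A n K) i 0)
        (aeval (Function.update (X : Fin (n + 1) → AffinePointBlowup.A n K) i 1) G) =
      aeval (Function.update (X : Fin (n + 1) → AffinePointBlowup.A n K) i 1) G := by
  classical
  rw [← AlgHom.comp_apply]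
  congr 1
  refine MvPolynomial.algHom_ext fun j => ?_
  rw [AlgHom.comp_apply, aeval_X]
  by_cases hj : j = i
  · subst hj
    rw [Function.update_self, map_one]
  · rw [Function.update_of_ne hj, aeval_X, Function.update_of_ne hj]

/-- **`xᵢ ∤ G(xᵢ := 1)`** for a non-zero form `G` (a multiple of `xᵢ` dies under `xᵢ := 0`, `G(xᵢ := 1)` does not). [folklore] -/
theorem not_X_dvd_aeval_update_one {G : AffinePointBlowup.A n K} {e : ℕ} (hG : G.IsHomogeneous e) (hG0 : G ≠ 0) :
    ¬ X i ∣ aeval (Function.update (X : Fin (n + 1) → AffinePointBlowup.A n K) i 1) G := by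
  classical
  rintro ⟨Q, hQ⟩
  apply aeval_update_one_ne_zero i hG hG0
  rw [← aeval_update_zero_aeval_update_one i G, hQ, map_mul, aeval_X, Function.update_self, zero_mul]

/-! ## The chart ring of the blown-up affine cone -/

/-- `xᵢ` is prime in `K[x]` (Mathlib `MvPolynomial.X_prime`). [folklore] -/
theorem prime_X : Prime (X i : AffinePointBlowup.A n K) :=
  MvPolynomial.X_prime

/-- In the chart ring `K[x][𝔪/xᵢ]`, the image of `xᵢ` is the image of `xᵢ` under `chartRingEquiv` (`substHom i xᵢ = xᵢ`). [folklore] -/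
theorem algebraMap_X_eq_chartRingEquiv :
    algebraMap (AffinePointBlowup.A n K) (PointBlowup.Chart n K i) (X i) = AffinePointBlowup.chartRingEquiv n K i (X i) := by
  rw [← AffinePointBlowup.chartRingEquiv_substHom, AffinePointBlowup.substHom_X_self]

/-- **The equation of the cone factors on the chart**: `G = xᵢ ^ e · G'` in `K[x][𝔪/xᵢ]` with `G' = chartRingEquiv (G(xᵢ := 1))`.
[cite: GortzWedhorn2020, Prop. 13.96 (2) and p. 416] -/
theorem algebraMap_eq_pow_mul_chartRingEquiv {G : AffinePointBlowup.A n K} {e : ℕ} (hG : G.IsHomogeneous e) :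
    algebraMap (AffinePointBlowup.A n K) (PointBlowup.Chart n K i) G =
      algebraMap (AffinePointBlowup.A n K) (PointBlowup.Chart n K i) (X i) ^ e *
        AffinePointBlowup.chartRingEquiv n K i
          (aeval (Function.update (X : Fin (n + 1) → AffinePointBlowup.A n K) i 1) G) := by
  rw [← AffinePointBlowup.chartRingEquiv_substHom, substHom_eq_X_pow_mul_of_isHomogeneous i hG, map_mul, map_pow,
    algebraMap_X_eq_chartRingEquiv]

/-- ★ **The `i`-th chart of the blown-up affine cone**: `K[X]/(G(Xᵢ := 1)) ≅ (K[X]/(G))[𝔪̄/X̄ᵢ]`, the affine blowup algebra of the affine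
cone `K[X]/(G)` along the vertex ideal `𝔪̄`, `𝔪 = (X₀, …, Xₙ)`, at the generator `X̄ᵢ` — for every non-zero form `G` of degree `e` over
every field `K`. [cite: GortzWedhorn2020, Prop. 13.96 (2) and p. 416] [cite: EisenbudHarris2016, §9.3.2] -/
theorem nonempty_quotient_aeval_update_one_ringEquiv_blowupAlgebra {G : AffinePointBlowup.A n K} {e : ℕ} (hG : G.IsHomogeneous e)
    (hG0 : G ≠ 0) :
    Nonempty ((AffinePointBlowup.A n K ⧸
        Ideal.span {aeval (Function.update (X : Fin (n + 1) → AffinePointBlowup.A n K) i 1) G}) ≃+*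
      blowupAlgebra ((PointBlowup.originIdeal n K).map (Ideal.Quotient.mk (Ideal.span {G})))
        (Ideal.Quotient.mk (Ideal.span {G}) (X i))) := by
  have hprime : Prime (algebraMap (AffinePointBlowup.A n K) (PointBlowup.Chart n K i) (X i)) := by
    rw [algebraMap_X_eq_chartRingEquiv]
    exact (MulEquiv.prime_iff (AffinePointBlowup.chartRingEquiv n K i)).mpr (prime_X i)
  have hndvd : ¬ algebraMap (AffinePointBlowup.A n K) (PointBlowup.Chart n K i) (X i) ∣
      AffinePointBlowup.chartRingEquiv n K i
        (aeval (Function.update (X : Fin (n + 1) → AffinePointBlowup.A n K) i 1) G) := by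
    rw [algebraMap_X_eq_chartRingEquiv]
    intro h
    exact not_X_dvd_aeval_update_one i hG hG0
      ((map_dvd_iff (AffinePointBlowup.chartRingEquiv n K i)).mp h)
  refine ⟨(Ideal.quotientEquiv _ _ (AffinePointBlowup.chartRingEquiv n K i) ?_).trans
    (blowupAlgebra.quotientKerMapQuotientEquiv (PointBlowup.originIdeal n K) (X i)
      (algebraMap_eq_pow_mul_chartRingEquiv i hG) hprime hndvd)⟩
  rw [Ideal.map_span, Set.image_singleton]
  rfl

/-! ## Regularity of the blown-up affine cone, and a resolution of the affine cone -/

/-- The images `X̄ᵢ` generate the vertex ideal `𝔪̄ = 𝔪 (K[X]/(G))`. [folklore] -/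
theorem map_originIdeal_le_span (G : AffinePointBlowup.A n K) :
    (PointBlowup.originIdeal n K).map (Ideal.Quotient.mk (Ideal.span {G})) ≤
      Ideal.span (Set.range fun j : Fin (n + 1) => Ideal.Quotient.mk (Ideal.span {G}) (X j)) := by
  rw [Ideal.map_span, ← Set.range_comp]
  rfl

/-- ★ **If every chart ring `K[X]/(G(Xᵢ := 1))` is regular, the blow-up of the affine cone `Spec K[X]/(G)` in its vertex is a
regular scheme** (the model blow-up `affineBlowup 𝔪̄ = Proj` of the Rees algebra; its charts at the generators `X̄ᵢ` are the
`K[X]/(G(Xᵢ := 1))`, ✓ `affineBlowup.isRegular_of_isRegularRing_blowupAlgebra`).  Every field, every characteristic.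
[cite: GortzWedhorn2020, (13.19) p. 415 and Prop. 13.96 (2)] [cite: StacksProject, Tag 0804] -/
theorem isRegular_affineBlowup_cone_of_forall {G : AffinePointBlowup.A n K} {e : ℕ} (hG : G.IsHomogeneous e) (hG0 : G ≠ 0)
    (hreg : ∀ j : Fin (n + 1),
      IsRegularRing (AffinePointBlowup.A n K ⧸
        Ideal.span {aeval (Function.update (X : Fin (n + 1) → AffinePointBlowup.A n K) j 1) G})) :
    Scheme.IsRegular (affineBlowup ((PointBlowup.originIdeal n K).map (Ideal.Quotient.mk (Ideal.span {G})))) := by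
  refine affineBlowup.isRegular_of_isRegularRing_blowupAlgebra (fun j : Fin (n + 1) => Ideal.Quotient.mk (Ideal.span {G}) (X j))
    (fun j => Ideal.mem_map_of_mem _ (Ideal.subset_span ⟨j, rfl⟩)) (map_originIdeal_le_span G) fun j => ?_
  obtain ⟨eqv⟩ := nonempty_quotient_aeval_update_one_ringEquiv_blowupAlgebra j hG hG0
  haveI := hreg j
  exact IsRegularRing.of_ringEquiv eqv

/-- For a PRIME form `G` of degree `e ≥ 2`, the image of `X₀` in the domain `K[X]/(G)` is a non-zero-divisor (`G ∤ X₀` by degrees).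
[folklore] -/
theorem mk_X_mem_nonZeroDivisors {G : AffinePointBlowup.A n K} {e : ℕ} (hG : G.IsHomogeneous e) (hGp : Prime G) (he : 2 ≤ e)
    (j : Fin (n + 1)) :
    Ideal.Quotient.mk (Ideal.span {G}) (X j) ∈ nonZeroDivisors (AffinePointBlowup.A n K ⧸ Ideal.span {G}) := by
  haveI : (Ideal.span {G}).IsPrime := (Ideal.span_singleton_prime hGp.ne_zero).mpr hGp
  haveI : IsDomain (AffinePointBlowup.A n K ⧸ Ideal.span {G}) := Ideal.Quotient.isDomain _
  refine mem_nonZeroDivisors_of_ne_zero fun h0 => ?_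
  rw [Ideal.Quotient.eq_zero_iff_mem, Ideal.mem_span_singleton] at h0
  obtain ⟨H, hH⟩ := h0
  have hH0 : H ≠ 0 := by
    rintro rfl
    exact X_ne_zero j (by rw [hH, mul_zero])
  have hdeg := congrArg MvPolynomial.totalDegree hH
  rw [totalDegree_X, totalDegree_mul_of_isDomain hGp.ne_zero hH0, hG.totalDegree hGp.ne_zero] at hdeg
  omega

/-- ★ **The affine cone over a prime form `G` of degree `≥ 2` HAS A RESOLUTION OF SINGULARITIES as soon as every chart ring
`K[X]/(G(Xᵢ := 1))` is regular**: the blow-up of the vertex `Bl_𝔪̄ Spec K[X]/(G) → Spec K[X]/(G)` is proper, birational (`X̄₀` is a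
non-zero-divisor in `𝔪̄`) with regular source (✓ `hasResolution_Spec_of_isRegularRing_blowupAlgebra`).  Every field, every characteristic.
[cite: GortzWedhorn2020, Prop. 13.91 (3)–(4)] [cite: Hartshorne1977, II Ex. 7.12] -/
theorem hasResolution_Spec_cone_of_forall {G : AffinePointBlowup.A n K} {e : ℕ} (hG : G.IsHomogeneous e) (hGp : Prime G) (he : 2 ≤ e)
    (hreg : ∀ j : Fin (n + 1),
      IsRegularRing (AffinePointBlowup.A n K ⧸
        Ideal.span {aeval (Function.update (X : Fin (n + 1) → AffinePointBlowup.A n K) j 1) G})) :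
    Scheme.HasResolution (Spec (.of (AffinePointBlowup.A n K ⧸ Ideal.span {G}))) := by
  refine hasResolution_Spec_of_isRegularRing_blowupAlgebra
    (I := (PointBlowup.originIdeal n K).map (Ideal.Quotient.mk (Ideal.span {G}))) (IsNoetherian.noetherian _)
    (fun j : Fin (n + 1) => Ideal.Quotient.mk (Ideal.span {G}) (X j))
    (fun j => Ideal.mem_map_of_mem _ (Ideal.subset_span ⟨j, rfl⟩)) (map_originIdeal_le_span G)
    (a := Ideal.Quotient.mk (Ideal.span {G}) (X 0)) (Ideal.mem_map_of_mem _ (Ideal.subset_span ⟨0, rfl⟩))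
    (mk_X_mem_nonZeroDivisors hG hGp he 0) fun j => ?_
  obtain ⟨eqv⟩ := nonempty_quotient_aeval_update_one_ringEquiv_blowupAlgebra j hG hGp.ne_zero
  haveI := hreg j
  exact IsRegularRing.of_ringEquiv eqv

/-! ## The chart ring is a polynomial ring over the chart ring of the base `V₊(G) ∩ D₊(xᵢ)` -/

/-- Renaming `K[xⱼ : j ≠ i]` into `K[x]` and then to `K[xⱼ : j ≠ i][T]` (`xᵢ ↦ T`) is the inclusion of constants. [folklore] -/
theorem optionEquivLeft_rename_eq_C (D : MvPolynomial {j : Fin (n + 1) // j ≠ i} K) :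
    MvPolynomial.optionEquivLeft K {j : Fin (n + 1) // j ≠ i}
        (rename (Equiv.optionSubtypeNe i).symm (rename (Subtype.val : {j : Fin (n + 1) // j ≠ i} → Fin (n + 1)) D)) =
      Polynomial.C D := by
  rw [rename_rename]
  induction D using MvPolynomial.induction_on with
  | C c => rw [rename_C, optionEquivLeft_C]
  | add p q hp hq => rw [map_add, map_add, hp, hq, map_add]
  | mul_X p j hp =>
    rw [map_mul, map_mul, hp, rename_X, Function.comp_apply, Equiv.optionSubtypeNe_symm_of_ne j.2,
      optionEquivLeft_X_some, map_mul]

/-- ★ **`K[x]/(G(xᵢ := 1)) ≅ (K[xⱼ : j ≠ i]/(G(xᵢ := 1)))[T]`**: the chart ring of the blown-up cone is the polynomial ring in the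
exceptional coordinate `T = xᵢ` over the coordinate ring `K[xⱼ : j ≠ i]/(dehomogenize i G)` of the affine chart `D₊(xᵢ) ∩ V₊(G)` of
the base of the cone. [cite: EisenbudHarris2016, §9.3.2] [cite: Hartshorne1977, II Prop. 2.5 (b)] -/
theorem nonempty_quotient_aeval_update_one_ringEquiv_polynomial (G : AffinePointBlowup.A n K) :
    Nonempty ((AffinePointBlowup.A n K ⧸
        Ideal.span {aeval (Function.update (X : Fin (n + 1) → AffinePointBlowup.A n K) i 1) G}) ≃+*
      Polynomial (MvPolynomial {j : Fin (n + 1) // j ≠ i} K ⧸ Ideal.span {dehomogenize i G})) := by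
  classical
  let eqv : AffinePointBlowup.A n K ≃+* Polynomial (MvPolynomial {j : Fin (n + 1) // j ≠ i} K) :=
    ((renameEquiv K (Equiv.optionSubtypeNe i).symm).trans
      (MvPolynomial.optionEquivLeft K {j : Fin (n + 1) // j ≠ i})).toRingEquiv
  have himg : eqv (aeval (Function.update (X : Fin (n + 1) → AffinePointBlowup.A n K) i 1) G) =
      Polynomial.C (dehomogenize i G) := by
    rw [aeval_update_one_eq_rename_dehomogenize]
    exact optionEquivLeft_rename_eq_C i (dehomogenize i G)
  have h1 : (Ideal.span {Polynomial.C (dehomogenize i G)} : Ideal (Polynomial (MvPolynomial {j : Fin (n + 1) // j ≠ i} K))) =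
      Ideal.map (eqv : AffinePointBlowup.A n K →+* Polynomial (MvPolynomial {j : Fin (n + 1) // j ≠ i} K))
        (Ideal.span {aeval (Function.update (X : Fin (n + 1) → AffinePointBlowup.A n K) i 1) G}) := by
    rw [Ideal.map_span, Set.image_singleton, RingHom.coe_coe, himg]
  have h2 : (Ideal.span {Polynomial.C (dehomogenize i G)} : Ideal (Polynomial (MvPolynomial {j : Fin (n + 1) // j ≠ i} K))) =
      Ideal.map (Polynomial.C : MvPolynomial {j : Fin (n + 1) // j ≠ i} K →+* _) (Ideal.span {dehomogenize i G}) := by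
    rw [Ideal.map_span, Set.image_singleton]
  exact ⟨(Ideal.quotientEquiv _ _ eqv h1).trans
    ((Ideal.quotEquivOfEq h2).trans (Ideal.polynomialQuotientEquivQuotientPolynomial (Ideal.span {dehomogenize i G})).symm)⟩

/-- ★ **Regularity of the chart ring from regularity of the base chart**: if the coordinate ring `K[xⱼ : j ≠ i]/(dehomogenize i G)`
of `D₊(xᵢ) ∩ V₊(G)` is a regular ring, so is the chart ring `K[x]/(G(xᵢ := 1))` of the blown-up cone (a polynomial ring over a regular
ring is regular, Mathlib `Polynomial.isRegularRing_of_isRegularRing`). [cite: GortzWedhorn2020, Prop. 13.96 (2)] -/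
theorem isRegularRing_quotient_aeval_update_one (G : AffinePointBlowup.A n K)
    [IsRegularRing (MvPolynomial {j : Fin (n + 1) // j ≠ i} K ⧸ Ideal.span {dehomogenize i G})] :
    IsRegularRing (AffinePointBlowup.A n K ⧸
      Ideal.span {aeval (Function.update (X : Fin (n + 1) → AffinePointBlowup.A n K) i 1) G}) := by
  obtain ⟨eqv⟩ := nonempty_quotient_aeval_update_one_ringEquiv_polynomial i G
  exact IsRegularRing.of_ringEquiv (R := Polynomial (MvPolynomial {j : Fin (n + 1) // j ≠ i} K ⧸ Ideal.span {dehomogenize i G}))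
    eqv.symm

/-- ★★ **Blowing up the vertex resolves the affine cone over a regular projective hypersurface — every field, every characteristic.**
For a PRIME form `G ∈ K[x₀, …, xₙ]` of degree `e ≥ 2` all of whose standard affine charts `K[xⱼ : j ≠ i]/(G(xᵢ := 1))` (the coordinate
rings of `D₊(xᵢ) ∩ V₊(G) ⊆ ℙⁿ_K`) are regular rings: the blow-up of the affine cone `Spec K[x]/(G)` in its vertex is a regular scheme,
and `Spec K[x]/(G)` has a resolution of singularities. [cite: Hartshorne1977, II Ex. 7.12] [cite: GortzWedhorn2020, Prop. 13.91; Prop. 13.96 (2)] -/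
theorem hasResolution_Spec_cone_of_forall_base {G : AffinePointBlowup.A n K} {e : ℕ} (hG : G.IsHomogeneous e) (hGp : Prime G)
    (he : 2 ≤ e) (hreg : ∀ j : Fin (n + 1), IsRegularRing (MvPolynomial {l : Fin (n + 1) // l ≠ j} K ⧸ Ideal.span {dehomogenize j G})) :
    Scheme.IsRegular (affineBlowup ((PointBlowup.originIdeal n K).map (Ideal.Quotient.mk (Ideal.span {G})))) ∧
      Scheme.HasResolution (Spec (.of (AffinePointBlowup.A n K ⧸ Ideal.span {G}))) := by
  have hreg' : ∀ j : Fin (n + 1), IsRegularRing (AffinePointBlowup.A n K ⧸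
      Ideal.span {aeval (Function.update (X : Fin (n + 1) → AffinePointBlowup.A n K) j 1) G}) := fun j =>
    haveI := hreg j
    isRegularRing_quotient_aeval_update_one j G
  exact ⟨isRegular_affineBlowup_cone_of_forall hG hGp.ne_zero hreg', hasResolution_Spec_cone_of_forall hG hGp he hreg'⟩

end ConeChart

end Summit.ResolutionOfSingularities.ResolutionOfSingularities.Cruxes.EquisingularLift.StrataSplit

end
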